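import Summits.CriticalPhenomena.SAWScalingLimit.Theorems.SAWLoopFugacityFlowIsingBoundaryRatioWindowResistanceDefs
import Summits.CriticalPhenomena.SAWScalingLimit.Theorems.SAWLoopFugacityFlowIsingBoundaryRatioSideCrossSeparation
import Literature.Probability.LatticeModels.DiscreteExtremalLengthExternalArcsProofs
import HarnessLib

/-!
# Resistance bound for the window rectangle — the `3 × 3` block at the end of a face chain
(line `fk-anchor-transfer`, crux `IsingBoundaryRatio`, stmt-CriticalPhenomena-10650; second helper module of the
proof of `WindowExtResistanceBound`, `…IsingBoundaryRatioWindowResistanceDefs.lean`)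

The planar-topology step of the face-chain extraction along chart semicircles (Chelkak 2016, Prop. 6.2 (i),
elementary direction). For a Jordan domain `D`:

* `wer_block` — if the twelve outer unit segments of the `3 × 3` block of cells of `δℤ²` around a cell lie in
  `closure D`, then no frontier point of `D` lies in the open block: the exterior `(closure D)ᶜ` is open,
  connected and unbounded (`JordanDomain.isConnected_exterior`) and misses the frontier of the block, so it
  misses the open block, while frontier points are limits of exterior points
  (`JordanDomain.frontier_subset_closure_exterior'`);
* `wer_end_cell` — consequently, if the four corners of a cell are vertices of a finite set `E` of
  `Ω_δ`-edges and a frontier point of `D` lies within `δ/8` of the closed cell, then a corner of the cell, or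
  the far end of a present edge of `E` at a corner, is a boundary vertex of `E` (`DiscreteRect.bdVerts`):
  otherwise all lattice edges at the corners and at their neighbours are in `E`, in particular the twelve
  outer segments of the block are `Ω_δ`-edges, closed segments in `closure D`.

Also: points between two lattice points on a grid line lie on their segment (`wer_mem_segment_of_re/im`),
the lattice directions in coordinates (`wer_dir_val`). All statements are folklore.
-/

noncomputable section

open scoped Classical Topology
open Filter Set Metric SimpleGraph
open Literature.Probability.LatticeModels Literature.Probability.RandomPlanarGeometry
open Literature.Probability.Percolation (BondConfig)
open UpperHalfPlane (upperHalfPlaneSet)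

namespace Summit.CriticalPhenomena.SAWScalingLimit.Theorems.IsingBoundaryRatio

/-! ### Segments on grid lines -/

/-- A point on the horizontal line through two points, between them, lies on their segment. [folklore] -/
theorem wer_mem_segment_of_re {a b w : ℂ} (hab : a.re < b.re) (him : a.im = b.im) (hw : w.im = a.im)
    (h1 : a.re ≤ w.re) (h2 : w.re ≤ b.re) : w ∈ segment ℝ a b := by
  rw [segment_eq_image']
  refine ⟨(w.re - a.re) / (b.re - a.re), ⟨div_nonneg (by linarith) (by linarith),
    (div_le_one (by linarith)).2 (by linarith)⟩, ?_⟩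
  have hne : b.re - a.re ≠ 0 := by linarith
  apply Complex.ext
  · simp only [Complex.add_re, Complex.real_smul, Complex.mul_re, Complex.ofReal_re, Complex.sub_re,
      Complex.ofReal_im, Complex.sub_im, zero_mul, sub_zero]
    field_simp; ring
  · simp only [Complex.add_im, Complex.real_smul, Complex.mul_im, Complex.ofReal_re, Complex.sub_im,
      Complex.ofReal_im, Complex.sub_re, zero_mul, add_zero, him, sub_self, mul_zero, hw]

/-- A point on the vertical line through two points, between them, lies on their segment. [folklore] -/
theorem wer_mem_segment_of_im {a b w : ℂ} (hab : a.im < b.im) (hre : a.re = b.re) (hw : w.re = a.re)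
    (h1 : a.im ≤ w.im) (h2 : w.im ≤ b.im) : w ∈ segment ℝ a b := by
  rw [segment_eq_image']
  refine ⟨(w.im - a.im) / (b.im - a.im), ⟨div_nonneg (by linarith) (by linarith),
    (div_le_one (by linarith)).2 (by linarith)⟩, ?_⟩
  have hne : b.im - a.im ≠ 0 := by linarith
  apply Complex.ext
  · simp only [Complex.add_re, Complex.real_smul, Complex.mul_re, Complex.ofReal_re, Complex.sub_re,
      Complex.ofReal_im, Complex.sub_im, zero_mul, hre, sub_self, mul_zero, add_zero, hw]
  · simp only [Complex.add_im, Complex.real_smul, Complex.mul_im, Complex.ofReal_re, Complex.sub_im,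
      Complex.ofReal_im, Complex.sub_re, zero_mul, add_zero]
    field_simp; ring

/-! ### The block lemma -/

/-- **Block lemma.** If the twelve outer unit segments of the `3 × 3` block of cells around the cell
`(k, j)` lie in `closure D`, then no frontier point of `D` lies in the open block. [folklore] -/
theorem wer_block (D : JordanDomain) {δ : ℝ} (hδ : 0 < δ) (k j : ℤ)
    (hH : ∀ m n : ℤ, k - 1 ≤ m → m ≤ k + 1 → (n = j - 1 ∨ n = j + 2) →
      segment ℝ (meshPoint δ ![m, n]) (meshPoint δ ![m + 1, n]) ⊆ closure D.carrier)
    (hV : ∀ m n : ℤ, (m = k - 1 ∨ m = k + 2) → j - 1 ≤ n → n ≤ j + 1 →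
      segment ℝ (meshPoint δ ![m, n]) (meshPoint δ ![m, n + 1]) ⊆ closure D.carrier)
    {p : ℂ} (hp : p ∈ frontier D.carrier) (hp1 : δ * (k - 1) < p.re) (hp2 : p.re < δ * (k + 2))
    (hp3 : δ * (j - 1) < p.im) (hp4 : p.im < δ * (j + 2)) : False := by
  set B : Set ℂ := Ioo (δ * (k - 1)) (δ * (k + 2)) ×ℂ Ioo (δ * (j - 1)) (δ * (j + 2)) with hB
  have hBo : IsOpen B := isOpen_Ioo.reProdIm isOpen_Ioo
  have hlt1 : δ * (k - 1) < δ * (k + 2) := by nlinarith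
  have hlt2 : δ * (j - 1) < δ * (j + 2) := by nlinarith
  -- the frontier of the block lies in `closure D`
  have hthird : ∀ t : ℝ, δ * (k - 1) ≤ t → t ≤ δ * (k + 2) →
      ∃ m : ℤ, k - 1 ≤ m ∧ m ≤ k + 1 ∧ δ * m ≤ t ∧ t ≤ δ * (m + 1) := by
    intro t ht1 ht2
    by_cases h1 : t ≤ δ * k
    · exact ⟨k - 1, le_rfl, by omega, by push_cast; linarith, by push_cast; linarith⟩
    · by_cases h2 : t ≤ δ * (k + 1)
      · exact ⟨k, by omega, by omega, by linarith, by linarith⟩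
      · exact ⟨k + 1, by omega, le_rfl, by push_cast; linarith, by push_cast; linarith⟩
  have hthird' : ∀ t : ℝ, δ * (j - 1) ≤ t → t ≤ δ * (j + 2) →
      ∃ n : ℤ, j - 1 ≤ n ∧ n ≤ j + 1 ∧ δ * n ≤ t ∧ t ≤ δ * (n + 1) := by
    intro t ht1 ht2
    by_cases h1 : t ≤ δ * j
    · exact ⟨j - 1, le_rfl, by omega, by push_cast; linarith, by push_cast; linarith⟩
    · by_cases h2 : t ≤ δ * (j + 1)
      · exact ⟨j, by omega, by omega, by linarith, by linarith⟩
      · exact ⟨j + 1, by omega, le_rfl, by push_cast; linarith, by push_cast; linarith⟩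
  have hfr : frontier B ⊆ closure D.carrier := by
    intro w hw
    rw [hB, Complex.frontier_reProdIm, closure_Ioo hlt1.ne, closure_Ioo hlt2.ne, frontier_Ioo hlt1,
      frontier_Ioo hlt2] at hw
    rcases hw with ⟨hre, him⟩ | ⟨hre, him⟩
    · -- top or bottom side
      obtain ⟨m, hm1, hm2, ht1, ht2⟩ := hthird w.re hre.1 hre.2
      have hn : ∃ n : ℤ, (n = j - 1 ∨ n = j + 2) ∧ w.im = δ * n := by
        rcases him with h | h
        · exact ⟨j - 1, Or.inl rfl, by rw [h]; push_cast; ring⟩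
        · exact ⟨j + 2, Or.inr rfl, by rw [h]; push_cast; ring⟩
      obtain ⟨n, hn, hwn⟩ := hn
      refine hH m n hm1 hm2 hn (wer_mem_segment_of_re ?_ ?_ ?_ ?_ ?_) <;>
        simp only [meshPoint_re, meshPoint_im, Matrix.cons_val_zero, Matrix.cons_val_one] <;>
        push_cast <;> linarith
    · -- left or right side
      obtain ⟨n, hn1, hn2, ht1, ht2⟩ := hthird' w.im him.1 him.2
      have hm : ∃ m : ℤ, (m = k - 1 ∨ m = k + 2) ∧ w.re = δ * m := by
        rcases hre with h | h
        · exact ⟨k - 1, Or.inl rfl, by rw [h]; push_cast; ring⟩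
        · exact ⟨k + 2, Or.inr rfl, by rw [h]; push_cast; ring⟩
      obtain ⟨m, hm, hwm⟩ := hm
      refine hV m n hm hn1 hn2 (wer_mem_segment_of_im ?_ ?_ ?_ ?_ ?_) <;>
        simp only [meshPoint_re, meshPoint_im, Matrix.cons_val_zero, Matrix.cons_val_one] <;>
        push_cast <;> linarith
  -- the exterior misses the open block
  have hext : Disjoint B (closure D.carrier)ᶜ := by
    rw [Set.disjoint_iff]
    rintro x ⟨hxB, hxE⟩
    have hpre := D.isConnected_exterior.isPreconnected
    have hcover : (closure D.carrier)ᶜ ⊆ B ∪ (closure B)ᶜ := by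
      intro z hz
      by_cases hzB : z ∈ closure B
      · left
        by_contra hzB'
        exact hz (hfr ⟨hzB, by rwa [hBo.interior_eq]⟩)
      · exact Or.inr hzB
    rcases hpre.subset_or_subset hBo isClosed_closure.isOpen_compl
      ((disjoint_compl_right (a := B)).mono_right (Set.compl_subset_compl.2 subset_closure)) hcover with h | h
    · -- the exterior is unbounded
      have hbdd : Bornology.IsBounded (closure D.carrier ∪ B) :=
        D.isBounded.closure.union ((Metric.isBounded_Ioo _ _).reProdIm (Metric.isBounded_Ioo _ _))
      obtain ⟨z, hz⟩ : ∃ z : ℂ, z ∉ closure D.carrier ∪ B := by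
        by_contra hall
        push Not at hall
        exact NormedSpace.unbounded_univ ℝ ℂ (hbdd.subset fun z _ => hall z)
      rw [Set.mem_union, not_or] at hz
      exact hz.2 (h hz.1)
    · exact h hxE (subset_closure hxB)
  have hpB : p ∈ B := by
    rw [hB, Complex.mem_reProdIm]
    exact ⟨⟨hp1, hp2⟩, hp3, hp4⟩
  have hpcl : p ∈ closure (closure D.carrier)ᶜ := D.frontier_subset_closure_exterior' hp
  rw [Metric.mem_closure_iff] at hpcl
  obtain ⟨ε, hε, hball⟩ := Metric.isOpen_iff.1 hBo p hpB
  obtain ⟨x, hxE, hxd⟩ := hpcl ε hε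
  exact Set.disjoint_iff.1 hext ⟨hball (Metric.mem_ball'.2 hxd), hxE⟩



/-! ### The end cell -/

/-- The four lattice directions in coordinates. [folklore] -/
theorem wer_dir_val (k : Fin 4) :
    DiscreteRect.dir k = ![![(1 : ℤ), 0], ![0, 1], ![-1, 0], ![0, -1]] k := by
  fin_cases k <;> (funext l; fin_cases l <;> rfl)

/-- An `E`-edge is an `Ω_δ`-edge, so its closed segment lies in `closure Ω` (both orientations). [folklore] -/
theorem wer_segment_subset_of_mem {Ω : Set ℂ} {δ : ℝ} {E : Finset (Sym2 (Site 2))}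
    (hE : ∀ e ∈ E, e ∈ (discreteDomainGraph Ω δ).edgeSet) {x y : Site 2} (h : s(x, y) ∈ E) :
    segment ℝ (meshPoint δ x) (meshPoint δ y) ⊆ closure Ω ∧
      segment ℝ (meshPoint δ y) (meshPoint δ x) ⊆ closure Ω := by
  have hadj : (discreteDomainGraph Ω δ).Adj x y := hE _ h
  have hseg := (meshGraph_adj_iff.1 (discreteDomainGraph_adj_iff.1 hadj).1).2
  exact ⟨hseg, by rwa [segment_symm]⟩

/-- At a vertex of `E` that is not a boundary vertex, every lattice edge is in `E`. [folklore] -/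
theorem wer_mem_of_not_bdVerts {E : Finset (Sym2 (Site 2))} {x : Site 2} (hx : x ∈ DiscreteRect.verts E)
    (hbd : x ∉ DiscreteRect.bdVerts E) (k : Fin 4) : s(x, x + DiscreteRect.dir k) ∈ E := by
  by_contra h
  exact hbd ⟨k, hx, h⟩

/-- **End-cell lemma.** If the four corners of the cell `(k, j)` are vertices of `E ⊆ E(Ω_δ)` and a
frontier point of `D` lies within `δ/8` of a point of the closed cell, then some corner of the cell,
or the far end of a present lattice edge at a corner, is a boundary vertex of `E`. [folklore] -/
theorem wer_end_cell (D : JordanDomain) {δ : ℝ} (hδ : 0 < δ) {E : Finset (Sym2 (Site 2))}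
    (hE : ∀ e ∈ E, e ∈ (discreteDomainGraph D.carrier δ).edgeSet) {k j : ℤ}
    (hV : ∀ a b, Mesh.corner k j a b ∈ DiscreteRect.verts E)
    {z₁ p : ℂ} (hz₁ : z₁ ∈ closure (Mesh.cell δ k j)) (hp : p ∈ frontier D.carrier)
    (hpz : dist p z₁ < δ / 8) :
    ∃ u ∈ DiscreteRect.bdVerts E, (∃ a b, u = Mesh.corner k j a b) ∨
      (∃ a b, ∃ k' : Fin 4, u = Mesh.corner k j a b + DiscreteRect.dir k' ∧ s(Mesh.corner k j a b, u) ∈ E) := by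
  by_contra hcon
  push Not at hcon
  have hc : ∀ a b, Mesh.corner k j a b ∉ DiscreteRect.bdVerts E := fun a b h => (hcon _ h).1 a b rfl
  have hec : ∀ a b (k' : Fin 4), s(Mesh.corner k j a b, Mesh.corner k j a b + DiscreteRect.dir k') ∈ E :=
    fun a b k' => wer_mem_of_not_bdVerts (hV a b) (hc a b) k'
  have hsv : ∀ a b (k' : Fin 4), Mesh.corner k j a b + DiscreteRect.dir k' ∈ DiscreteRect.verts E :=
    fun a b k' => DiscreteRect.mem_verts_of_mem (hec a b k')
  have hsc : ∀ a b (k' : Fin 4), Mesh.corner k j a b + DiscreteRect.dir k' ∉ DiscreteRect.bdVerts E :=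
    fun a b k' h => (hcon _ h).2 a b k' rfl (hec a b k')
  have hes : ∀ a b (k' k'' : Fin 4),
      s(Mesh.corner k j a b + DiscreteRect.dir k', Mesh.corner k j a b + DiscreteRect.dir k' + DiscreteRect.dir k'') ∈ E :=
    fun a b k' k'' => wer_mem_of_not_bdVerts (hsv a b k') (hsc a b k') k''
  have hseg : ∀ a b (k' k'' : Fin 4) (x y : Site 2), x = Mesh.corner k j a b + DiscreteRect.dir k' →
      y = Mesh.corner k j a b + DiscreteRect.dir k' + DiscreteRect.dir k'' →
      segment ℝ (meshPoint δ x) (meshPoint δ y) ⊆ closure D.carrier ∧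
        segment ℝ (meshPoint δ y) (meshPoint δ x) ⊆ closure D.carrier := by
    rintro a b k' k'' x y rfl rfl
    exact wer_segment_subset_of_mem hE (hes a b k' k'')
  have hz : δ * k ≤ z₁.re ∧ z₁.re ≤ δ * (k + 1) ∧ δ * j ≤ z₁.im ∧ z₁.im ≤ δ * (j + 1) := by
    rw [Mesh.closure_cell hδ, Complex.mem_reProdIm] at hz₁
    exact ⟨hz₁.1.1, hz₁.1.2, hz₁.2.1, hz₁.2.2⟩
  have hpre : |p.re - z₁.re| < δ / 8 := (Complex.abs_re_le_norm (p - z₁)).trans_lt (by rwa [← Complex.dist_eq])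
  have hpim : |p.im - z₁.im| < δ / 8 := (Complex.abs_im_le_norm (p - z₁)).trans_lt (by rwa [← Complex.dist_eq])
  rw [abs_lt] at hpre hpim
  refine wer_block D hδ k j (fun m n hm1 hm2 hn => ?_) (fun m n hm hn1 hn2 => ?_) hp
    (by linarith) (by linarith) (by linarith) (by linarith)
  · -- horizontal outer segments
    have hm : m = k - 1 ∨ m = k ∨ m = k + 1 := by omega
    rcases hn with rfl | rfl <;> rcases hm with rfl | rfl | rfl
    · refine (hseg false false 3 2 _ _ ?_ ?_).2 <;> (funext l; fin_cases l <;> simp [Mesh.corner, wer_dir_val])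
      all_goals omega
    · refine (hseg false false 3 0 _ _ ?_ ?_).1 <;> (funext l; fin_cases l <;> simp [Mesh.corner, wer_dir_val])
      all_goals omega
    · refine (hseg true false 3 0 _ _ ?_ ?_).1 <;> (funext l; fin_cases l <;> simp [Mesh.corner, wer_dir_val])
      all_goals omega
    · refine (hseg false true 1 2 _ _ ?_ ?_).2 <;> (funext l; fin_cases l <;> simp [Mesh.corner, wer_dir_val])
      all_goals omega
    · refine (hseg false true 1 0 _ _ ?_ ?_).1 <;> (funext l; fin_cases l <;> simp [Mesh.corner, wer_dir_val])
      all_goals omega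
    · refine (hseg true true 1 0 _ _ ?_ ?_).1 <;> (funext l; fin_cases l <;> simp [Mesh.corner, wer_dir_val])
      all_goals omega
  · -- vertical outer segments
    have hn : n = j - 1 ∨ n = j ∨ n = j + 1 := by omega
    rcases hm with rfl | rfl <;> rcases hn with rfl | rfl | rfl
    · refine (hseg false false 2 3 _ _ ?_ ?_).2 <;> (funext l; fin_cases l <;> simp [Mesh.corner, wer_dir_val])
      all_goals omega
    · refine (hseg false false 2 1 _ _ ?_ ?_).1 <;> (funext l; fin_cases l <;> simp [Mesh.corner, wer_dir_val])
      all_goals omega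
    · refine (hseg false true 2 1 _ _ ?_ ?_).1 <;> (funext l; fin_cases l <;> simp [Mesh.corner, wer_dir_val])
      all_goals omega
    · refine (hseg true false 0 3 _ _ ?_ ?_).2 <;> (funext l; fin_cases l <;> simp [Mesh.corner, wer_dir_val])
      all_goals omega
    · refine (hseg true false 0 1 _ _ ?_ ?_).1 <;> (funext l; fin_cases l <;> simp [Mesh.corner, wer_dir_val])
      all_goals omega
    · refine (hseg true true 0 1 _ _ ?_ ?_).1 <;> (funext l; fin_cases l <;> simp [Mesh.corner, wer_dir_val])
      all_goals omega


/-- The block lemma, closed form (registered sub-goal of stmt-CriticalPhenomena-10650). [folklore] -/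
theorem wer_block' : ∀ (D : JordanDomain) {δ : ℝ}, 0 < δ → ∀ (k j : ℤ), (∀ m n : ℤ, k - 1 ≤ m → m ≤ k + 1 → (n = j - 1 ∨ n = j + 2) → segment ℝ (meshPoint δ ![m, n]) (meshPoint δ ![m + 1, n]) ⊆ closure D.carrier) → (∀ m n : ℤ, (m = k - 1 ∨ m = k + 2) → j - 1 ≤ n → n ≤ j + 1 → segment ℝ (meshPoint δ ![m, n]) (meshPoint δ ![m, n + 1]) ⊆ closure D.carrier) → ∀ {p : ℂ}, p ∈ frontier D.carrier → δ * (k - 1) < p.re → p.re < δ * (k + 2) → δ * (j - 1) < p.im → p.im < δ * (j + 2) → False :=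
  fun D _ hδ k j hH hV _ hp hp1 hp2 hp3 hp4 => wer_block D hδ k j hH hV hp hp1 hp2 hp3 hp4

end Summit.CriticalPhenomena.SAWScalingLimit.Theorems.IsingBoundaryRatio

end
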